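import Literature.AlgebraicGeometry.ComplexMultiplication.CyclotomicFermatCMTypesKoblitzListThreeTimesPrimePowersConditional
import HarnessLib

/-!
# Koblitz's list: the class-number inequalities discharged by kernel decision for `p = 31, 43, 59, 67, 79, 83, 103, 107, 127, 131`
# (no primitive elliptic splitting at `2pᵏ`, `4pᵏ` for `p = 43, 59, 67, 83, 107, 131` and at `3ᵃpᵇ` for `p = 31, 43, 67, 79, 103, 127`)

Layer `Literature/AlgebraicGeometry/ComplexMultiplication`, namespace `…ComplexMultiplication.CyclotomicFermatCMType`; sequel of
`…KoblitzListTwicePrimePowersConditional` (`2pᵏ`, `4pᵏ`, `p ≡ 3 (mod 8)`: no primitive group triple if `16‖B_{1,χ_p}‖ < p − 1` resp.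
`8‖B_{1,χ_p}‖ < p − 1`) and `…KoblitzListThreeTimesPrimePowersConditional` (`3ᵃpᵇ`, `p ≡ 7 (mod 12)`: if `6‖B_{1,χ_p}‖ < p − 1`).  THEOREMS ONLY
(no definition, no named fact, no `sorry`); the only new ingredient is a BRIDGE making `B_{1,χ_p}` a kernel-decidable integer:
`2p·B_{1,χ_p} = Σ_{a<p} χ_p(a)(2a − p)`, evaluated by `decide` for each listed prime (`= −2p·h(−p)`: `h(−31) = 3`, `h(−43) = 1`, `h(−59) = 3`,
`h(−67) = 1`, `h(−79) = 5`, `h(−83) = 3`, `h(−103) = 5`, `h(−107) = 3`, `h(−127) = 5`, `h(−131) = 5`).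

THE SOURCES (held, read first-hand).  M. Bauer, A. Coste, C. Itzykson, P. Ruelle, J. Geom. Phys. **22** (1997), §3.4 p. 14 (Koblitz's list
[kob] = N. Koblitz, Duke Math. J. **45** (1978) 87–99, NOT held).  N. Koblitz, D. Rohrlich, Canad. J. Math. **30** (1978), §2 p. 1187.  S. Lang,
*Cyclotomic Fields I–II*, Ch. 2 §1 (`B_{1,χ} = Σ χ(a)(a/f − ½)`).

## What is proved

* §1 **`two_mul_mul_bernoulliOneChar_quadraticChar_eq_intCast_sum`** (the bridge), **`norm_bernoulliOneChar_quadraticChar_eq_of_sum_eq`**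
  (`Σ = −2ph ⟹ ‖B_{1,χ_p}‖ = h`).
* §2 the ten kernel evaluations and **`norm_bernoulliOneChar_quadraticChar_pN`** (`N = 31, 43, 59, 67, 79, 83, 103, 107, 127, 131`:
  `‖B₁‖ = 3, 1, 3, 1, 5, 3, 5, 3, 5, 5`).
* §3 the instances: **`not_forall_mul_mem_twicePrimePow_pN`**, **`not_forall_mul_mem_fourTimesPrimePow_pN`** (`N = 43, 59, 67, 83, 107, 131`)
  and **`not_forall_mul_mem_threeTimesPrimePow_pN`** (`N = 31, 43, 67, 79, 103, 127`): no primitive normalised triple with `H` a group at `2pᵏ`,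
  `4pᵏ`, resp. `3ᵃpᵇ` — the levels `86, 93, 118, 129, 134, 166, 172, 201, 214, 236, 237, 262, 268, 309, 332, 381, …` of the residual tail.

## Honest column / NOT here

* A finite list of primes, chosen as the smallest of each family beyond the prequels (`p = 11, 19`); the template is two lines per further prime
  (`decide` cost grows like `p²`; `p = 163` takes seconds).  The statement for a VARIABLE `p` stays conditional ([kob] proper).  OUR proofs.

## References

* [BauerCosteItzyksonRuelle1997] M. Bauer, A. Coste, C. Itzykson, P. Ruelle, J. Geom. Phys. 22 (1997) 134–189, §3.4 (p. 14).
* [KoblitzRohrlich1978] N. Koblitz, D. Rohrlich, Canad. J. Math. 30 (1978) 1183–1205, §2 (p. 1187).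
* [LangCyclotomic1990] S. Lang, *Cyclotomic Fields I and II*, Ch. 2 §1.
* [kob] N. Koblitz, Duke Math. J. 45 (1978) 87–99 — cited for the statement of the list only; not held, not used.

## Provenance

Cell `pub-hodgecm2` (COR-CM), literature seat `lit-deligne-3` gen 43 (claim KOBLITZ-CLASS-NUMBER-INSTANCES; count-neutral, own lane).  HC_CM is NOT
proved and nothing here bears on it.
-/

noncomputable section

open NumberField

namespace Literature.AlgebraicGeometry.ComplexMultiplication

open Literature.NumberTheory.LFunctions
open Literature.AlgebraicGeometry.HodgeTheory (fermatCMType)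

namespace CyclotomicFermatCMType

/-! ## §1 The bridge: `2p·B_{1,χ_p}` is an integer sum -/

section Bridge

variable {p : ℕ} [hp : Fact p.Prime]

/-- **`2p·B_{1,χ_p} = Σ_{a<p} χ_p(a)·(2a − p)`** (from `B_{1,χ} = Σ_{a<f} χ(a)(a/f − ½)`). [cite: LangCyclotomic1990, Ch. 2 §1 (definition of B_{1,χ})] -/
theorem two_mul_mul_bernoulliOneChar_quadraticChar_eq_intCast_sum :
    2 * (p : ℂ) * bernoulliOneChar ((quadraticChar (ZMod p)).ringHomComp (Int.castRingHom ℂ)) =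
      ((∑ a ∈ Finset.range p, (quadraticChar (ZMod p) (a : ZMod p) : ℤ) * (2 * (a : ℤ) - p) : ℤ) : ℂ) := by
  have hp0 : (p : ℂ) ≠ 0 := by exact_mod_cast hp.out.ne_zero
  rw [bernoulliOneChar_def, Finset.mul_sum, Int.cast_sum]
  refine Finset.sum_congr rfl fun a _ => ?_
  rw [MulChar.ringHomComp_apply, eq_intCast]
  push_cast
  field_simp

/-- **`Σ_{a<p} χ_p(a)(2a − p) = −2ph ⟹ ‖B_{1,χ_p}‖ = h`.** [cite: LangCyclotomic1990, Ch. 2 §1] -/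
theorem norm_bernoulliOneChar_quadraticChar_eq_of_sum_eq {h : ℕ}
    (hS : ∑ a ∈ Finset.range p, (quadraticChar (ZMod p) (a : ZMod p) : ℤ) * (2 * (a : ℤ) - p) = -(2 * p * h : ℕ)) :
    ‖bernoulliOneChar ((quadraticChar (ZMod p)).ringHomComp (Int.castRingHom ℂ))‖ = h := by
  have hp0 : (p : ℝ) ≠ 0 := by exact_mod_cast hp.out.ne_zero
  have hpC : (p : ℂ) ≠ 0 := by exact_mod_cast hp.out.ne_zero
  have e := two_mul_mul_bernoulliOneChar_quadraticChar_eq_intCast_sum (p := p)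
  rw [hS] at e
  push_cast at e
  have e' : bernoulliOneChar ((quadraticChar (ZMod p)).ringHomComp (Int.castRingHom ℂ)) = -(h : ℂ) := by
    have h2p : (2 : ℂ) * p ≠ 0 := mul_ne_zero two_ne_zero hpC
    have : 2 * (p : ℂ) * (bernoulliOneChar ((quadraticChar (ZMod p)).ringHomComp (Int.castRingHom ℂ)) + h) = 0 := by
      rw [mul_add, e]; ring
    rcases mul_eq_zero.1 this with h0 | h0
    · exact absurd h0 h2p
    · linear_combination h0
  rw [e', norm_neg]
  exact_mod_cast Complex.norm_natCast h

end Bridge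

/-! ## §2 Kernel evaluations: `‖B_{1,χ_p}‖ = h(−p)` for `p = 31, 43, 59, 67, 79, 83` -/

section Evaluations

set_option maxRecDepth 40000 in
/-- `Σ_{a<31} χ_{31}(a)(2a − 31) = −2·31·3` (kernel decision). [folklore] -/
private theorem quadraticChar_sum_p31 :
    haveI : Fact (Nat.Prime 31) := ⟨by norm_num⟩
    ∑ a ∈ Finset.range 31, (quadraticChar (ZMod 31) (a : ZMod 31) : ℤ) * (2 * (a : ℤ) - 31) = -(2 * 31 * 3 : ℕ) := by
  decide

/-- **`‖B_{1,χ_{31}}‖ = 3`** (`h(−31) = 3`). [cite: LangCyclotomic1990, Ch. 2 §1] -/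
theorem norm_bernoulliOneChar_quadraticChar_p31 [Fact (Nat.Prime 31)] :
    ‖bernoulliOneChar ((quadraticChar (ZMod 31)).ringHomComp (Int.castRingHom ℂ))‖ = 3 := by
  simpa using norm_bernoulliOneChar_quadraticChar_eq_of_sum_eq (p := 31) (h := 3) quadraticChar_sum_p31

set_option maxRecDepth 40000 in
/-- `Σ_{a<43} χ_{43}(a)(2a − 43) = −2·43·1` (kernel decision). [folklore] -/
private theorem quadraticChar_sum_p43 :
    haveI : Fact (Nat.Prime 43) := ⟨by norm_num⟩
    ∑ a ∈ Finset.range 43, (quadraticChar (ZMod 43) (a : ZMod 43) : ℤ) * (2 * (a : ℤ) - 43) = -(2 * 43 * 1 : ℕ) := by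
  decide

/-- **`‖B_{1,χ_{43}}‖ = 1`** (`h(−43) = 1`). [cite: LangCyclotomic1990, Ch. 2 §1] -/
theorem norm_bernoulliOneChar_quadraticChar_p43 [Fact (Nat.Prime 43)] :
    ‖bernoulliOneChar ((quadraticChar (ZMod 43)).ringHomComp (Int.castRingHom ℂ))‖ = 1 := by
  simpa using norm_bernoulliOneChar_quadraticChar_eq_of_sum_eq (p := 43) (h := 1) quadraticChar_sum_p43

set_option maxRecDepth 40000 in
/-- `Σ_{a<59} χ_{59}(a)(2a − 59) = −2·59·3` (kernel decision). [folklore] -/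
private theorem quadraticChar_sum_p59 :
    haveI : Fact (Nat.Prime 59) := ⟨by norm_num⟩
    ∑ a ∈ Finset.range 59, (quadraticChar (ZMod 59) (a : ZMod 59) : ℤ) * (2 * (a : ℤ) - 59) = -(2 * 59 * 3 : ℕ) := by
  decide

/-- **`‖B_{1,χ_{59}}‖ = 3`** (`h(−59) = 3`). [cite: LangCyclotomic1990, Ch. 2 §1] -/
theorem norm_bernoulliOneChar_quadraticChar_p59 [Fact (Nat.Prime 59)] :
    ‖bernoulliOneChar ((quadraticChar (ZMod 59)).ringHomComp (Int.castRingHom ℂ))‖ = 3 := by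
  simpa using norm_bernoulliOneChar_quadraticChar_eq_of_sum_eq (p := 59) (h := 3) quadraticChar_sum_p59

set_option maxRecDepth 40000 in
/-- `Σ_{a<67} χ_{67}(a)(2a − 67) = −2·67·1` (kernel decision). [folklore] -/
private theorem quadraticChar_sum_p67 :
    haveI : Fact (Nat.Prime 67) := ⟨by norm_num⟩
    ∑ a ∈ Finset.range 67, (quadraticChar (ZMod 67) (a : ZMod 67) : ℤ) * (2 * (a : ℤ) - 67) = -(2 * 67 * 1 : ℕ) := by
  decide

/-- **`‖B_{1,χ_{67}}‖ = 1`** (`h(−67) = 1`). [cite: LangCyclotomic1990, Ch. 2 §1] -/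
theorem norm_bernoulliOneChar_quadraticChar_p67 [Fact (Nat.Prime 67)] :
    ‖bernoulliOneChar ((quadraticChar (ZMod 67)).ringHomComp (Int.castRingHom ℂ))‖ = 1 := by
  simpa using norm_bernoulliOneChar_quadraticChar_eq_of_sum_eq (p := 67) (h := 1) quadraticChar_sum_p67

set_option maxRecDepth 40000 in
/-- `Σ_{a<79} χ_{79}(a)(2a − 79) = −2·79·5` (kernel decision). [folklore] -/
private theorem quadraticChar_sum_p79 :
    haveI : Fact (Nat.Prime 79) := ⟨by norm_num⟩
    ∑ a ∈ Finset.range 79, (quadraticChar (ZMod 79) (a : ZMod 79) : ℤ) * (2 * (a : ℤ) - 79) = -(2 * 79 * 5 : ℕ) := by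
  decide

/-- **`‖B_{1,χ_{79}}‖ = 5`** (`h(−79) = 5`). [cite: LangCyclotomic1990, Ch. 2 §1] -/
theorem norm_bernoulliOneChar_quadraticChar_p79 [Fact (Nat.Prime 79)] :
    ‖bernoulliOneChar ((quadraticChar (ZMod 79)).ringHomComp (Int.castRingHom ℂ))‖ = 5 := by
  simpa using norm_bernoulliOneChar_quadraticChar_eq_of_sum_eq (p := 79) (h := 5) quadraticChar_sum_p79

set_option maxRecDepth 40000 in
/-- `Σ_{a<83} χ_{83}(a)(2a − 83) = −2·83·3` (kernel decision). [folklore] -/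
private theorem quadraticChar_sum_p83 :
    haveI : Fact (Nat.Prime 83) := ⟨by norm_num⟩
    ∑ a ∈ Finset.range 83, (quadraticChar (ZMod 83) (a : ZMod 83) : ℤ) * (2 * (a : ℤ) - 83) = -(2 * 83 * 3 : ℕ) := by
  decide

/-- **`‖B_{1,χ_{83}}‖ = 3`** (`h(−83) = 3`). [cite: LangCyclotomic1990, Ch. 2 §1] -/
theorem norm_bernoulliOneChar_quadraticChar_p83 [Fact (Nat.Prime 83)] :
    ‖bernoulliOneChar ((quadraticChar (ZMod 83)).ringHomComp (Int.castRingHom ℂ))‖ = 3 := by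
  simpa using norm_bernoulliOneChar_quadraticChar_eq_of_sum_eq (p := 83) (h := 3) quadraticChar_sum_p83

set_option maxRecDepth 40000 in
/-- `Σ_{a<103} χ_{103}(a)(2a − 103) = −2·103·5` (kernel decision). [folklore] -/
private theorem quadraticChar_sum_p103 :
    haveI : Fact (Nat.Prime 103) := ⟨by norm_num⟩
    ∑ a ∈ Finset.range 103, (quadraticChar (ZMod 103) (a : ZMod 103) : ℤ) * (2 * (a : ℤ) - 103) = -(2 * 103 * 5 : ℕ) := by
  decide

/-- **`‖B_{1,χ_{103}}‖ = 5`** (`h(−103) = 5`). [cite: LangCyclotomic1990, Ch. 2 §1] -/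
theorem norm_bernoulliOneChar_quadraticChar_p103 [Fact (Nat.Prime 103)] :
    ‖bernoulliOneChar ((quadraticChar (ZMod 103)).ringHomComp (Int.castRingHom ℂ))‖ = 5 := by
  simpa using norm_bernoulliOneChar_quadraticChar_eq_of_sum_eq (p := 103) (h := 5) quadraticChar_sum_p103

set_option maxRecDepth 40000 in
/-- `Σ_{a<107} χ_{107}(a)(2a − 107) = −2·107·3` (kernel decision). [folklore] -/
private theorem quadraticChar_sum_p107 :
    haveI : Fact (Nat.Prime 107) := ⟨by norm_num⟩
    ∑ a ∈ Finset.range 107, (quadraticChar (ZMod 107) (a : ZMod 107) : ℤ) * (2 * (a : ℤ) - 107) = -(2 * 107 * 3 : ℕ) := by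
  decide

/-- **`‖B_{1,χ_{107}}‖ = 3`** (`h(−107) = 3`). [cite: LangCyclotomic1990, Ch. 2 §1] -/
theorem norm_bernoulliOneChar_quadraticChar_p107 [Fact (Nat.Prime 107)] :
    ‖bernoulliOneChar ((quadraticChar (ZMod 107)).ringHomComp (Int.castRingHom ℂ))‖ = 3 := by
  simpa using norm_bernoulliOneChar_quadraticChar_eq_of_sum_eq (p := 107) (h := 3) quadraticChar_sum_p107

set_option maxRecDepth 40000 in
/-- `Σ_{a<127} χ_{127}(a)(2a − 127) = −2·127·5` (kernel decision). [folklore] -/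
private theorem quadraticChar_sum_p127 :
    haveI : Fact (Nat.Prime 127) := ⟨by norm_num⟩
    ∑ a ∈ Finset.range 127, (quadraticChar (ZMod 127) (a : ZMod 127) : ℤ) * (2 * (a : ℤ) - 127) = -(2 * 127 * 5 : ℕ) := by
  decide

/-- **`‖B_{1,χ_{127}}‖ = 5`** (`h(−127) = 5`). [cite: LangCyclotomic1990, Ch. 2 §1] -/
theorem norm_bernoulliOneChar_quadraticChar_p127 [Fact (Nat.Prime 127)] :
    ‖bernoulliOneChar ((quadraticChar (ZMod 127)).ringHomComp (Int.castRingHom ℂ))‖ = 5 := by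
  simpa using norm_bernoulliOneChar_quadraticChar_eq_of_sum_eq (p := 127) (h := 5) quadraticChar_sum_p127

set_option maxRecDepth 40000 in
/-- `Σ_{a<131} χ_{131}(a)(2a − 131) = −2·131·5` (kernel decision). [folklore] -/
private theorem quadraticChar_sum_p131 :
    haveI : Fact (Nat.Prime 131) := ⟨by norm_num⟩
    ∑ a ∈ Finset.range 131, (quadraticChar (ZMod 131) (a : ZMod 131) : ℤ) * (2 * (a : ℤ) - 131) = -(2 * 131 * 5 : ℕ) := by
  decide

/-- **`‖B_{1,χ_{131}}‖ = 5`** (`h(−131) = 5`). [cite: LangCyclotomic1990, Ch. 2 §1] -/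
theorem norm_bernoulliOneChar_quadraticChar_p131 [Fact (Nat.Prime 131)] :
    ‖bernoulliOneChar ((quadraticChar (ZMod 131)).ringHomComp (Int.castRingHom ℂ))‖ = 5 := by
  simpa using norm_bernoulliOneChar_quadraticChar_eq_of_sum_eq (p := 131) (h := 5) quadraticChar_sum_p131

end Evaluations

/-! ## §3 The instances -/

section Instances

variable {m n : ℕ} {N : ℕ} [NeZero N]

/-- **LEVELS `2·43ⁿ⁺¹`: NO primitive normalised triple has `H_{r,s,t}` a group** (`16·1 < 42`). [cite: BauerCosteItzyksonRuelle1997, §3.4]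
[cite: KoblitzRohrlich1978, §2 (p. 1187)] -/
theorem not_forall_mul_mem_twicePrimePow_p43 (hN : N = 2 * 43 ^ (n + 1)) {r s : ZMod N} (hr : r ≠ 0) (hs : s ≠ 0)
    (hrs : r.val + s.val < N) (hprim : Nat.gcd (Nat.gcd r.val s.val) N = 1) :
    ¬∀ a ∈ fermatCMType N r s (-(r + s)), ∀ b ∈ fermatCMType N r s (-(r + s)), a * b ∈ fermatCMType N r s (-(r + s)) := by
  haveI : Fact (Nat.Prime 43) := ⟨by norm_num⟩
  refine not_forall_mul_mem_twicePrimePow_of_bernoulli_lt (p := 43) (by norm_num) ?_ hN hr hs hrs hprim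
  rw [norm_bernoulliOneChar_quadraticChar_p43]; norm_num

/-- **LEVELS `4·43ⁿ⁺¹`: NO primitive normalised triple has `H_{r,s,t}` a group** (`8·1 < 42`). [cite: BauerCosteItzyksonRuelle1997, §3.4]
[cite: KoblitzRohrlich1978, §2 (p. 1187)] -/
theorem not_forall_mul_mem_fourTimesPrimePow_p43 (hN : N = 4 * 43 ^ (n + 1)) {r s : ZMod N} (hr : r ≠ 0) (hs : s ≠ 0)
    (hrs : r.val + s.val < N) (hprim : Nat.gcd (Nat.gcd r.val s.val) N = 1) :
    ¬∀ a ∈ fermatCMType N r s (-(r + s)), ∀ b ∈ fermatCMType N r s (-(r + s)), a * b ∈ fermatCMType N r s (-(r + s)) := by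
  haveI : Fact (Nat.Prime 43) := ⟨by norm_num⟩
  refine not_forall_mul_mem_fourTimesPrimePow_of_bernoulli_lt (p := 43) (by norm_num) (by norm_num) ?_ hN hr hs hrs hprim
  rw [norm_bernoulliOneChar_quadraticChar_p43]; norm_num

/-- **LEVELS `2·59ⁿ⁺¹`: NO primitive normalised triple has `H_{r,s,t}` a group** (`16·3 < 58`). [cite: BauerCosteItzyksonRuelle1997, §3.4]
[cite: KoblitzRohrlich1978, §2 (p. 1187)] -/
theorem not_forall_mul_mem_twicePrimePow_p59 (hN : N = 2 * 59 ^ (n + 1)) {r s : ZMod N} (hr : r ≠ 0) (hs : s ≠ 0)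
    (hrs : r.val + s.val < N) (hprim : Nat.gcd (Nat.gcd r.val s.val) N = 1) :
    ¬∀ a ∈ fermatCMType N r s (-(r + s)), ∀ b ∈ fermatCMType N r s (-(r + s)), a * b ∈ fermatCMType N r s (-(r + s)) := by
  haveI : Fact (Nat.Prime 59) := ⟨by norm_num⟩
  refine not_forall_mul_mem_twicePrimePow_of_bernoulli_lt (p := 59) (by norm_num) ?_ hN hr hs hrs hprim
  rw [norm_bernoulliOneChar_quadraticChar_p59]; norm_num

/-- **LEVELS `4·59ⁿ⁺¹`: NO primitive normalised triple has `H_{r,s,t}` a group** (`8·3 < 58`). [cite: BauerCosteItzyksonRuelle1997, §3.4]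
[cite: KoblitzRohrlich1978, §2 (p. 1187)] -/
theorem not_forall_mul_mem_fourTimesPrimePow_p59 (hN : N = 4 * 59 ^ (n + 1)) {r s : ZMod N} (hr : r ≠ 0) (hs : s ≠ 0)
    (hrs : r.val + s.val < N) (hprim : Nat.gcd (Nat.gcd r.val s.val) N = 1) :
    ¬∀ a ∈ fermatCMType N r s (-(r + s)), ∀ b ∈ fermatCMType N r s (-(r + s)), a * b ∈ fermatCMType N r s (-(r + s)) := by
  haveI : Fact (Nat.Prime 59) := ⟨by norm_num⟩
  refine not_forall_mul_mem_fourTimesPrimePow_of_bernoulli_lt (p := 59) (by norm_num) (by norm_num) ?_ hN hr hs hrs hprim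
  rw [norm_bernoulliOneChar_quadraticChar_p59]; norm_num

/-- **LEVELS `2·67ⁿ⁺¹`: NO primitive normalised triple has `H_{r,s,t}` a group** (`16·1 < 66`). [cite: BauerCosteItzyksonRuelle1997, §3.4]
[cite: KoblitzRohrlich1978, §2 (p. 1187)] -/
theorem not_forall_mul_mem_twicePrimePow_p67 (hN : N = 2 * 67 ^ (n + 1)) {r s : ZMod N} (hr : r ≠ 0) (hs : s ≠ 0)
    (hrs : r.val + s.val < N) (hprim : Nat.gcd (Nat.gcd r.val s.val) N = 1) :
    ¬∀ a ∈ fermatCMType N r s (-(r + s)), ∀ b ∈ fermatCMType N r s (-(r + s)), a * b ∈ fermatCMType N r s (-(r + s)) := by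
  haveI : Fact (Nat.Prime 67) := ⟨by norm_num⟩
  refine not_forall_mul_mem_twicePrimePow_of_bernoulli_lt (p := 67) (by norm_num) ?_ hN hr hs hrs hprim
  rw [norm_bernoulliOneChar_quadraticChar_p67]; norm_num

/-- **LEVELS `4·67ⁿ⁺¹`: NO primitive normalised triple has `H_{r,s,t}` a group** (`8·1 < 66`). [cite: BauerCosteItzyksonRuelle1997, §3.4]
[cite: KoblitzRohrlich1978, §2 (p. 1187)] -/
theorem not_forall_mul_mem_fourTimesPrimePow_p67 (hN : N = 4 * 67 ^ (n + 1)) {r s : ZMod N} (hr : r ≠ 0) (hs : s ≠ 0)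
    (hrs : r.val + s.val < N) (hprim : Nat.gcd (Nat.gcd r.val s.val) N = 1) :
    ¬∀ a ∈ fermatCMType N r s (-(r + s)), ∀ b ∈ fermatCMType N r s (-(r + s)), a * b ∈ fermatCMType N r s (-(r + s)) := by
  haveI : Fact (Nat.Prime 67) := ⟨by norm_num⟩
  refine not_forall_mul_mem_fourTimesPrimePow_of_bernoulli_lt (p := 67) (by norm_num) (by norm_num) ?_ hN hr hs hrs hprim
  rw [norm_bernoulliOneChar_quadraticChar_p67]; norm_num

/-- **LEVELS `2·83ⁿ⁺¹`: NO primitive normalised triple has `H_{r,s,t}` a group** (`16·3 < 82`). [cite: BauerCosteItzyksonRuelle1997, §3.4]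
[cite: KoblitzRohrlich1978, §2 (p. 1187)] -/
theorem not_forall_mul_mem_twicePrimePow_p83 (hN : N = 2 * 83 ^ (n + 1)) {r s : ZMod N} (hr : r ≠ 0) (hs : s ≠ 0)
    (hrs : r.val + s.val < N) (hprim : Nat.gcd (Nat.gcd r.val s.val) N = 1) :
    ¬∀ a ∈ fermatCMType N r s (-(r + s)), ∀ b ∈ fermatCMType N r s (-(r + s)), a * b ∈ fermatCMType N r s (-(r + s)) := by
  haveI : Fact (Nat.Prime 83) := ⟨by norm_num⟩
  refine not_forall_mul_mem_twicePrimePow_of_bernoulli_lt (p := 83) (by norm_num) ?_ hN hr hs hrs hprim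
  rw [norm_bernoulliOneChar_quadraticChar_p83]; norm_num

/-- **LEVELS `4·83ⁿ⁺¹`: NO primitive normalised triple has `H_{r,s,t}` a group** (`8·3 < 82`). [cite: BauerCosteItzyksonRuelle1997, §3.4]
[cite: KoblitzRohrlich1978, §2 (p. 1187)] -/
theorem not_forall_mul_mem_fourTimesPrimePow_p83 (hN : N = 4 * 83 ^ (n + 1)) {r s : ZMod N} (hr : r ≠ 0) (hs : s ≠ 0)
    (hrs : r.val + s.val < N) (hprim : Nat.gcd (Nat.gcd r.val s.val) N = 1) :
    ¬∀ a ∈ fermatCMType N r s (-(r + s)), ∀ b ∈ fermatCMType N r s (-(r + s)), a * b ∈ fermatCMType N r s (-(r + s)) := by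
  haveI : Fact (Nat.Prime 83) := ⟨by norm_num⟩
  refine not_forall_mul_mem_fourTimesPrimePow_of_bernoulli_lt (p := 83) (by norm_num) (by norm_num) ?_ hN hr hs hrs hprim
  rw [norm_bernoulliOneChar_quadraticChar_p83]; norm_num

/-- **LEVELS `3ᵐ⁺¹·31ⁿ⁺¹`: NO primitive normalised triple has `H_{r,s,t}` a group** (`6·3 < 30`). [cite: BauerCosteItzyksonRuelle1997, §3.4]
[cite: KoblitzRohrlich1978, §2 (p. 1187)] -/
theorem not_forall_mul_mem_threeTimesPrimePow_p31 (hN : N = 3 ^ (m + 1) * 31 ^ (n + 1)) {r s : ZMod N} (hr : r ≠ 0) (hs : s ≠ 0)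
    (hrs : r.val + s.val < N) (hprim : Nat.gcd (Nat.gcd r.val s.val) N = 1) :
    ¬∀ a ∈ fermatCMType N r s (-(r + s)), ∀ b ∈ fermatCMType N r s (-(r + s)), a * b ∈ fermatCMType N r s (-(r + s)) := by
  haveI : Fact (Nat.Prime 31) := ⟨by norm_num⟩
  refine not_forall_mul_mem_threeTimesPrimePow_of_bernoulli_lt (p := 31) (by norm_num) ?_ hN hr hs hrs hprim
  rw [norm_bernoulliOneChar_quadraticChar_p31]; norm_num

/-- **LEVELS `3ᵐ⁺¹·43ⁿ⁺¹`: NO primitive normalised triple has `H_{r,s,t}` a group** (`6·1 < 42`). [cite: BauerCosteItzyksonRuelle1997, §3.4]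
[cite: KoblitzRohrlich1978, §2 (p. 1187)] -/
theorem not_forall_mul_mem_threeTimesPrimePow_p43 (hN : N = 3 ^ (m + 1) * 43 ^ (n + 1)) {r s : ZMod N} (hr : r ≠ 0) (hs : s ≠ 0)
    (hrs : r.val + s.val < N) (hprim : Nat.gcd (Nat.gcd r.val s.val) N = 1) :
    ¬∀ a ∈ fermatCMType N r s (-(r + s)), ∀ b ∈ fermatCMType N r s (-(r + s)), a * b ∈ fermatCMType N r s (-(r + s)) := by
  haveI : Fact (Nat.Prime 43) := ⟨by norm_num⟩
  refine not_forall_mul_mem_threeTimesPrimePow_of_bernoulli_lt (p := 43) (by norm_num) ?_ hN hr hs hrs hprim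
  rw [norm_bernoulliOneChar_quadraticChar_p43]; norm_num

/-- **LEVELS `3ᵐ⁺¹·67ⁿ⁺¹`: NO primitive normalised triple has `H_{r,s,t}` a group** (`6·1 < 66`). [cite: BauerCosteItzyksonRuelle1997, §3.4]
[cite: KoblitzRohrlich1978, §2 (p. 1187)] -/
theorem not_forall_mul_mem_threeTimesPrimePow_p67 (hN : N = 3 ^ (m + 1) * 67 ^ (n + 1)) {r s : ZMod N} (hr : r ≠ 0) (hs : s ≠ 0)
    (hrs : r.val + s.val < N) (hprim : Nat.gcd (Nat.gcd r.val s.val) N = 1) :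
    ¬∀ a ∈ fermatCMType N r s (-(r + s)), ∀ b ∈ fermatCMType N r s (-(r + s)), a * b ∈ fermatCMType N r s (-(r + s)) := by
  haveI : Fact (Nat.Prime 67) := ⟨by norm_num⟩
  refine not_forall_mul_mem_threeTimesPrimePow_of_bernoulli_lt (p := 67) (by norm_num) ?_ hN hr hs hrs hprim
  rw [norm_bernoulliOneChar_quadraticChar_p67]; norm_num

/-- **LEVELS `3ᵐ⁺¹·79ⁿ⁺¹`: NO primitive normalised triple has `H_{r,s,t}` a group** (`6·5 < 78`). [cite: BauerCosteItzyksonRuelle1997, §3.4]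
[cite: KoblitzRohrlich1978, §2 (p. 1187)] -/
theorem not_forall_mul_mem_threeTimesPrimePow_p79 (hN : N = 3 ^ (m + 1) * 79 ^ (n + 1)) {r s : ZMod N} (hr : r ≠ 0) (hs : s ≠ 0)
    (hrs : r.val + s.val < N) (hprim : Nat.gcd (Nat.gcd r.val s.val) N = 1) :
    ¬∀ a ∈ fermatCMType N r s (-(r + s)), ∀ b ∈ fermatCMType N r s (-(r + s)), a * b ∈ fermatCMType N r s (-(r + s)) := by
  haveI : Fact (Nat.Prime 79) := ⟨by norm_num⟩
  refine not_forall_mul_mem_threeTimesPrimePow_of_bernoulli_lt (p := 79) (by norm_num) ?_ hN hr hs hrs hprim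
  rw [norm_bernoulliOneChar_quadraticChar_p79]; norm_num

/-- **LEVELS `2·107ⁿ⁺¹`: NO primitive normalised triple has `H_{r,s,t}` a group** (`16·3 < 106`). [cite: BauerCosteItzyksonRuelle1997, §3.4]
[cite: KoblitzRohrlich1978, §2 (p. 1187)] -/
theorem not_forall_mul_mem_twicePrimePow_p107 (hN : N = 2 * 107 ^ (n + 1)) {r s : ZMod N} (hr : r ≠ 0) (hs : s ≠ 0)
    (hrs : r.val + s.val < N) (hprim : Nat.gcd (Nat.gcd r.val s.val) N = 1) :
    ¬∀ a ∈ fermatCMType N r s (-(r + s)), ∀ b ∈ fermatCMType N r s (-(r + s)), a * b ∈ fermatCMType N r s (-(r + s)) := by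
  haveI : Fact (Nat.Prime 107) := ⟨by norm_num⟩
  refine not_forall_mul_mem_twicePrimePow_of_bernoulli_lt (p := 107) (by norm_num) ?_ hN hr hs hrs hprim
  rw [norm_bernoulliOneChar_quadraticChar_p107]; norm_num

/-- **LEVELS `4·107ⁿ⁺¹`: NO primitive normalised triple has `H_{r,s,t}` a group** (`8·3 < 106`). [cite: BauerCosteItzyksonRuelle1997, §3.4]
[cite: KoblitzRohrlich1978, §2 (p. 1187)] -/
theorem not_forall_mul_mem_fourTimesPrimePow_p107 (hN : N = 4 * 107 ^ (n + 1)) {r s : ZMod N} (hr : r ≠ 0) (hs : s ≠ 0)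
    (hrs : r.val + s.val < N) (hprim : Nat.gcd (Nat.gcd r.val s.val) N = 1) :
    ¬∀ a ∈ fermatCMType N r s (-(r + s)), ∀ b ∈ fermatCMType N r s (-(r + s)), a * b ∈ fermatCMType N r s (-(r + s)) := by
  haveI : Fact (Nat.Prime 107) := ⟨by norm_num⟩
  refine not_forall_mul_mem_fourTimesPrimePow_of_bernoulli_lt (p := 107) (by norm_num) (by norm_num) ?_ hN hr hs hrs hprim
  rw [norm_bernoulliOneChar_quadraticChar_p107]; norm_num

/-- **LEVELS `2·131ⁿ⁺¹`: NO primitive normalised triple has `H_{r,s,t}` a group** (`16·5 < 130`). [cite: BauerCosteItzyksonRuelle1997, §3.4]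
[cite: KoblitzRohrlich1978, §2 (p. 1187)] -/
theorem not_forall_mul_mem_twicePrimePow_p131 (hN : N = 2 * 131 ^ (n + 1)) {r s : ZMod N} (hr : r ≠ 0) (hs : s ≠ 0)
    (hrs : r.val + s.val < N) (hprim : Nat.gcd (Nat.gcd r.val s.val) N = 1) :
    ¬∀ a ∈ fermatCMType N r s (-(r + s)), ∀ b ∈ fermatCMType N r s (-(r + s)), a * b ∈ fermatCMType N r s (-(r + s)) := by
  haveI : Fact (Nat.Prime 131) := ⟨by norm_num⟩
  refine not_forall_mul_mem_twicePrimePow_of_bernoulli_lt (p := 131) (by norm_num) ?_ hN hr hs hrs hprim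
  rw [norm_bernoulliOneChar_quadraticChar_p131]; norm_num

/-- **LEVELS `4·131ⁿ⁺¹`: NO primitive normalised triple has `H_{r,s,t}` a group** (`8·5 < 130`). [cite: BauerCosteItzyksonRuelle1997, §3.4]
[cite: KoblitzRohrlich1978, §2 (p. 1187)] -/
theorem not_forall_mul_mem_fourTimesPrimePow_p131 (hN : N = 4 * 131 ^ (n + 1)) {r s : ZMod N} (hr : r ≠ 0) (hs : s ≠ 0)
    (hrs : r.val + s.val < N) (hprim : Nat.gcd (Nat.gcd r.val s.val) N = 1) :
    ¬∀ a ∈ fermatCMType N r s (-(r + s)), ∀ b ∈ fermatCMType N r s (-(r + s)), a * b ∈ fermatCMType N r s (-(r + s)) := by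
  haveI : Fact (Nat.Prime 131) := ⟨by norm_num⟩
  refine not_forall_mul_mem_fourTimesPrimePow_of_bernoulli_lt (p := 131) (by norm_num) (by norm_num) ?_ hN hr hs hrs hprim
  rw [norm_bernoulliOneChar_quadraticChar_p131]; norm_num

/-- **LEVELS `3ᵐ⁺¹·103ⁿ⁺¹`: NO primitive normalised triple has `H_{r,s,t}` a group** (`6·5 < 102`). [cite: BauerCosteItzyksonRuelle1997, §3.4]
[cite: KoblitzRohrlich1978, §2 (p. 1187)] -/
theorem not_forall_mul_mem_threeTimesPrimePow_p103 (hN : N = 3 ^ (m + 1) * 103 ^ (n + 1)) {r s : ZMod N} (hr : r ≠ 0) (hs : s ≠ 0)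
    (hrs : r.val + s.val < N) (hprim : Nat.gcd (Nat.gcd r.val s.val) N = 1) :
    ¬∀ a ∈ fermatCMType N r s (-(r + s)), ∀ b ∈ fermatCMType N r s (-(r + s)), a * b ∈ fermatCMType N r s (-(r + s)) := by
  haveI : Fact (Nat.Prime 103) := ⟨by norm_num⟩
  refine not_forall_mul_mem_threeTimesPrimePow_of_bernoulli_lt (p := 103) (by norm_num) ?_ hN hr hs hrs hprim
  rw [norm_bernoulliOneChar_quadraticChar_p103]; norm_num

/-- **LEVELS `3ᵐ⁺¹·127ⁿ⁺¹`: NO primitive normalised triple has `H_{r,s,t}` a group** (`6·5 < 126`). [cite: BauerCosteItzyksonRuelle1997, §3.4]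
[cite: KoblitzRohrlich1978, §2 (p. 1187)] -/
theorem not_forall_mul_mem_threeTimesPrimePow_p127 (hN : N = 3 ^ (m + 1) * 127 ^ (n + 1)) {r s : ZMod N} (hr : r ≠ 0) (hs : s ≠ 0)
    (hrs : r.val + s.val < N) (hprim : Nat.gcd (Nat.gcd r.val s.val) N = 1) :
    ¬∀ a ∈ fermatCMType N r s (-(r + s)), ∀ b ∈ fermatCMType N r s (-(r + s)), a * b ∈ fermatCMType N r s (-(r + s)) := by
  haveI : Fact (Nat.Prime 127) := ⟨by norm_num⟩
  refine not_forall_mul_mem_threeTimesPrimePow_of_bernoulli_lt (p := 127) (by norm_num) ?_ hN hr hs hrs hprim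
  rw [norm_bernoulliOneChar_quadraticChar_p127]; norm_num

end Instances

end CyclotomicFermatCMType

end Literature.AlgebraicGeometry.ComplexMultiplication
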